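import Summits.CriticalPhenomena.CardyFormulaZ2.Theorems.CardyIKTransportCornerLineDescentLine

/-!
# Locality of the crude crossing event of the corner-line gauge (stub `stub_Locality`)

Registered stub `stub_Locality` of the line `symmetric-seed-second-order` of the crux
`CardyIKTransport.CornerLineDescent` (stmt-CriticalPhenomena-10964), over the shared vocabulary
`Theorems/CardyIKTransportCornerLineDescentLine.lean`: for every conformal rectangle `R` and mesh `δ > 0` the
crude crossing event `crossingEvent R δ` of the explicit i.i.d.-bit gauge is determined by finitely many bits of
each of the five factors (`CrossingEventLocalAt R δ`).  This is the combinatorial half of the Margulis–Russo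
formula of the line (consumed by `stub_Russo`) and the finite-support fact behind every influence bound.

Proof (Grimmett 1999, §2.2, "events defined in terms of finitely many edges", made explicit for this model):
* `exists_window_subset_box`: `R.carrier` is bounded, so the lattice window `{v | δ (v0 + i v1) ∈ R.carrier}` lies
  in a box `[-N, N]²`;
* `openCrossing_congr`: an open crossing inside the window only reads edges with both endpoints in the window;
* `mem_gaugeEdges_congr`: such an edge is black iff a condition on the colours of its endpoints and on the coins
  at two neighbouring faces holds, so it reads colours in `[-N, N]²` and coins in `[-N-1, N+1]²`;
* `gaugeColour_congr`: the colour of a cell `v` of `[-N, N]²` reads the column bit `v0`, the row bit `v1` and the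
  syndromes of the rectangle between `0` and `v`, all indexed in `[-N, N]`; the fourth factor is never read.
Hence `K₁ = K₂ = [-N, N]`, `K₃ = [-N, N]²`, `K₄ = ∅`, `K₅ = [-N-1, N+1]²` work.
-/

noncomputable section

namespace Summit.CriticalPhenomena.CardyFormulaZ2.Theorems.CornerLineDescent.SymmetricSeed

open scoped BigOperators Topology Classical MeasureTheory ProbabilityTheory ENNReal NNReal
open Filter Set Function MeasureTheory
open Literature.Probability.Percolation (sitePercolation bondPercolation half BondConfig embDomainCrossing rectangle)
open Literature.Probability.LatticeModels
open Literature.Probability.RandomPlanarGeometry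

/-! ## Helpers for the stub `stub_Locality`

The crude crossing event reads the bond configuration `gaugeEdges ω` only on pairs of cells of the finite lattice
window of the bounded domain; an edge between two cells of a box is decided by the colours of its endpoints and two
coins next to them; a colour is decided by one column bit, one row bit and the syndromes of a finite rectangle. -/

/-- Two sets that have the same trace on `K` have the same members in `K`. [folklore] -/
private theorem mem_congr_of_inter_eq {α : Type*} {X X' K : Set α} (h : X ∩ K = X' ∩ K) {a : α}
    (ha : a ∈ K) : a ∈ X ↔ a ∈ X' :=
  ⟨fun hx => ((Set.ext_iff.1 h a).1 ⟨hx, ha⟩).1, fun hx => ((Set.ext_iff.1 h a).2 ⟨hx, ha⟩).1⟩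

/-- An open crossing inside `S` only reads the edges with both endpoints in `S`
(Grimmett 1999, §2.2, cylinder events; cf. `PlanarDuality.determinedBy_openCrossing`). [folklore] -/
private theorem openCrossing_congr {V : Type*} {S A B : Set V} {ω ω' : BondConfig V}
    (h : ∀ u ∈ S, ∀ v ∈ S, (s(u, v) ∈ ω ↔ s(u, v) ∈ ω')) :
    ω ∈ Literature.Probability.Percolation.openCrossing S A B ↔
      ω' ∈ Literature.Probability.Percolation.openCrossing S A B := by
  have key : (Literature.Probability.Percolation.openGraph ω).induce S =
      (Literature.Probability.Percolation.openGraph ω').induce S := by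
    ext u v
    simp only [SimpleGraph.comap_adj, Function.Embedding.coe_subtype,
      Literature.Probability.Percolation.openGraph_adj, h u.1 u.2 v.1 v.2]
  simp only [Literature.Probability.Percolation.mem_openCrossing_iff,
    Literature.Probability.Percolation.openConnIn, Set.mem_setOf_eq, key]

/-- The abstract shape of `gaugeColour`: two bits and the parity of a filtered finite set; agreement of the bits and
of the filter predicate on the finite set gives the same colour. [folklore] -/
private theorem xor_xor_odd_congr {A A' B B' : Prop} {p q : ℤ × ℤ → Prop} [DecidablePred p]
    [DecidablePred q] {S : Finset (ℤ × ℤ)} (hA : A ↔ A') (hB : B ↔ B') (hpq : ∀ f ∈ S, p f ↔ q f) :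
    Xor A (Xor B (Odd (S.filter p).card)) ↔ Xor A' (Xor B' (Odd (S.filter q).card)) := by
  rw [hA, hB, Finset.filter_congr hpq]

/-- LOCALITY OF THE COLOUR: `gaugeColour ω v` for `v` in the box `[-M, M]²` reads the column bits and row bits on
`[-M, M]` and the syndromes in the box `[-M, M]²` only (the fourth factor is never read at `S = univ`). [folklore] -/
theorem gaugeColour_congr {M : ℕ} {ω ω' : Bits}
    (hA : ω.1 ∩ ↑(Finset.Icc (-(M : ℤ)) M) = ω'.1 ∩ ↑(Finset.Icc (-(M : ℤ)) M))
    (hB : ω.2.1 ∩ ↑(Finset.Icc (-(M : ℤ)) M) = ω'.2.1 ∩ ↑(Finset.Icc (-(M : ℤ)) M))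
    (hD : ω.2.2.1 ∩ ↑(box 2 M) = ω'.2.2.1 ∩ ↑(box 2 M)) {v : Site 2} (hv : v ∈ box 2 M) :
    gaugeColour ω v ↔ gaugeColour ω' v := by
  rw [mem_box] at hv
  have h0 : v 0 ∈ ω.1 ↔ v 0 ∈ ω'.1 := mem_congr_of_inter_eq hA (by simpa using hv 0)
  have h1 : v 1 ∈ ω.2.1 ↔ v 1 ∈ ω'.2.1 := mem_congr_of_inter_eq hB (by simpa using hv 1)
  simp only [gaugeColour]
  refine xor_xor_odd_congr h0 h1 fun f hf => ?_
  have hf' : (![f.1, f.2] : Site 2) ∈ (↑(box 2 M) : Set (Site 2)) := by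
    rw [Finset.mem_product, Finset.mem_Ico, Finset.mem_Ico] at hf
    rw [Finset.mem_coe, mem_box, Fin.forall_fin_two]
    simp only [Matrix.cons_val_zero, Matrix.cons_val_one]
    obtain ⟨h0l, h0r⟩ := hv 0
    obtain ⟨h1l, h1r⟩ := hv 1
    omega
  simp only [Set.mem_univ, true_and, not_true_eq_false, false_and, or_false,
    mem_congr_of_inter_eq hD hf']

/-- The saddle coin at `S = univ` is the coin bit. [folklore] -/
theorem gaugeCoin_iff (ω : Bits) (f : Site 2) : gaugeCoin ω f ↔ f ∈ ω.2.2.2.2 := by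
  simp [gaugeCoin]

/-- One direction of `mem_gaugeEdges_congr`. [folklore] -/
private theorem mem_gaugeEdges_of_agree {N : ℕ} {ω ω' : Bits}
    (hcol : ∀ w ∈ box 2 N, (gaugeColour ω w ↔ gaugeColour ω' w))
    (hcoin : ∀ f ∈ box 2 (N + 1), (gaugeCoin ω f ↔ gaugeCoin ω' f))
    {u v : Site 2} (hu : u ∈ box 2 N) (hv : v ∈ box 2 N) (h : s(u, v) ∈ gaugeEdges ω) :
    s(u, v) ∈ gaugeEdges ω' := by
  obtain ⟨u', v', he, hu', hv', hstep⟩ := h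
  have hmem : u' ∈ box 2 N ∧ v' ∈ box 2 N := by
    rcases Sym2.eq_iff.1 he with ⟨h1, h2⟩ | ⟨h1, h2⟩
    · exact ⟨h1 ▸ hu, h2 ▸ hv⟩
    · exact ⟨h2 ▸ hv, h1 ▸ hu⟩
  have hshift : u' + ![0, -1] ∈ box 2 (N + 1) := by
    have hb := mem_box.1 hmem.1
    rw [mem_box, Fin.forall_fin_two]
    simp only [Pi.add_apply, Matrix.cons_val_zero, Matrix.cons_val_one]
    obtain ⟨h0l, h0r⟩ := hb 0
    obtain ⟨h1l, h1r⟩ := hb 1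
    push_cast
    omega
  refine ⟨u', v', he, (hcol u' hmem.1).1 hu', (hcol v' hmem.2).1 hv', ?_⟩
  rw [← hcoin u' (box_mono 2 (Nat.le_succ N) hmem.1), ← hcoin _ hshift]
  exact hstep

/-- LOCALITY OF THE EDGES: whether the edge `s(u, v)` between two cells of the box `[-N, N]²` is black depends only
on the colours in that box and the coins in the box `[-N-1, N+1]²`. [folklore] -/
theorem mem_gaugeEdges_congr {N : ℕ} {ω ω' : Bits}
    (hcol : ∀ w ∈ box 2 N, (gaugeColour ω w ↔ gaugeColour ω' w))
    (hcoin : ∀ f ∈ box 2 (N + 1), (gaugeCoin ω f ↔ gaugeCoin ω' f))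
    {u v : Site 2} (hu : u ∈ box 2 N) (hv : v ∈ box 2 N) :
    s(u, v) ∈ gaugeEdges ω ↔ s(u, v) ∈ gaugeEdges ω' :=
  ⟨mem_gaugeEdges_of_agree hcol hcoin hu hv,
    mem_gaugeEdges_of_agree (fun w hw => (hcol w hw).symm) (fun f hf => (hcoin f hf).symm) hu hv⟩

/-- FINITE WINDOW: for `δ > 0` the cells `v` with `δ (v0 + i v1)` in the bounded domain `R.carrier` lie in a
finite box `[-N, N]²`. [folklore] -/
theorem exists_window_subset_box (R : ConformalRectangle) {δ : ℝ} (hδ : 0 < δ) :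
    ∃ N : ℕ, ∀ y : Site 2,
      (δ : ℂ) * (((y 0 : ℝ) : ℂ) + ((y 1 : ℝ) : ℂ) * Complex.I) ∈ R.carrier → y ∈ box 2 N := by
  obtain ⟨r, hr⟩ := (Metric.isBounded_iff_subset_closedBall (0 : ℂ)).1 R.isBounded
  refine ⟨⌈r / δ⌉₊, fun y hy => ?_⟩
  have hnorm : ‖(δ : ℂ) * (((y 0 : ℝ) : ℂ) + ((y 1 : ℝ) : ℂ) * Complex.I)‖ ≤ r :=
    mem_closedBall_zero_iff.1 (hr hy)
  have hcoord : ∀ t : ℤ, |δ * (t : ℝ)| ≤ r → -(⌈r / δ⌉₊ : ℤ) ≤ t ∧ t ≤ ⌈r / δ⌉₊ := by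
    intro t ht
    rw [abs_mul, abs_of_pos hδ] at ht
    have h1 : |(t : ℝ)| ≤ r / δ := by
      rw [le_div_iff₀ hδ, mul_comm]
      exact ht
    have h2 := abs_le.1 (h1.trans (Nat.le_ceil _))
    constructor <;> [have h3 := h2.1; have h3 := h2.2] <;> exact_mod_cast h3
  have hre : |δ * ((y 0 : ℤ) : ℝ)| ≤ r := by
    have h := (Complex.abs_re_le_norm _).trans hnorm
    simpa [Complex.mul_re, Complex.add_re, Complex.mul_im, Complex.add_im] using h
  have him : |δ * ((y 1 : ℤ) : ℝ)| ≤ r := by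
    have h := (Complex.abs_im_le_norm _).trans hnorm
    simpa [Complex.mul_re, Complex.add_re, Complex.mul_im, Complex.add_im] using h
  rw [mem_box, Fin.forall_fin_two]
  exact ⟨hcoord _ hre, hcoord _ him⟩

/-! ## The stub -/

/-- Registered stub `stub_Locality` of crux stmt-CriticalPhenomena-10964 (line `symmetric-seed-second-order`). [folklore] -/
theorem stub_Locality :
    ∀ (R : ConformalRectangle) (δ : ℝ), 0 < δ → CrossingEventLocalAt R δ := by
  intro R δ hδ
  obtain ⟨N, hN⟩ := exists_window_subset_box R hδ
  refine ⟨Finset.Icc (-(N : ℤ)) N, Finset.Icc (-(N : ℤ)) N, box 2 N, ∅, box 2 (N + 1), ?_⟩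
  intro ω ω' hA hB hD _ hC
  have hcol : ∀ w ∈ box 2 N, (gaugeColour ω w ↔ gaugeColour ω' w) := fun w hw =>
    gaugeColour_congr hA hB hD hw
  have hcoin : ∀ f ∈ box 2 (N + 1), (gaugeCoin ω f ↔ gaugeCoin ω' f) := fun f hf => by
    rw [gaugeCoin_iff, gaugeCoin_iff]
    exact mem_congr_of_inter_eq hC (Finset.mem_coe.2 hf)
  exact openCrossing_congr fun u hu v hv => mem_gaugeEdges_congr hcol hcoin (hN u hu) (hN v hv)

end Summit.CriticalPhenomena.CardyFormulaZ2.Theorems.CornerLineDescent.SymmetricSeed
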